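import Mathlib
import Summits.ResolutionOfSingularities.ResolutionOfSingularities.Theorems.HomologicalConductorPersistenceSurfaceSaturationCompletionGorenstein
import Summits.ResolutionOfSingularities.ResolutionOfSingularities.Theorems.HomologicalConductorPersistenceSurfaceDoorNonGorenstein
import HarnessLib

/-!
# Rung S-2 `PersistenceSurface` (stmt-ResolutionOfSingularities-19970) — the fourth saturation residual and the door of
# record with the Gorenstein input read on the COMPLETION of the stage

Route `ResolutionOfSingularities/HomologicalConductor`, chain W4.4b, rung S-2 `PersistenceSurface`
(stmt-ResolutionOfSingularities-19970), registered skeleton 1a77c002 (stubs `stub_saturationFourSurfaceResidualFour`,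
`stub_completedStepPersistenceRationalNormal'`, `stub_levelFourPersistenceNonnormalOrNonrational'`).
[OURS · bookkeeping over LANDED tree lemmas; AI-written, weaker than expert review; NOT a statement of the manuscript
under study (Hironaka 2017) and no statement of that manuscript is used.]  DEF-FREE; every premise is a hypothesis.

The door of record `persistenceSurface_of_nonGorensteinSat_of_completedStep'_of_restSingular` (p797085) asks for `Sat₄`
at the residual stages `T_m` that are not Gorenstein AS RINGS (`¬ ∀ W f.g., ∀ i ≥ 3, Extⁱ_{T_m}(W, T_m) = 0`).  With the
completion door (`…SaturationCompletionGorenstein`, p807841: `Sat₃(T)` whenever `T̂` is Gorenstein, `T` a normal surface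
stage) the Gorenstein test moves to the COMPLETED local ring `T̂_m`, where singularity theory presents the stage
(`T̂ ≅ k'⟦x⟧/(f)`; complete intersections by equation count, `…SaturationRegularSequenceExt`, p807481/p807685):

* `saturationFourSurfaceResidual₄_of_stageZero_of_nonGorensteinCompletion` — `SaturationFourSurfaceResidual₄` follows
  from (0) `Sat₄` at stage `0` under the residual clauses and (NĜ) `Sat₄` at every INTEGRALLY CLOSED residual stage
  `T_m` whose completion `T̂_m` is NOT Gorenstein (`¬ ∀ W f.g., ∀ i ≥ 3, Extⁱ_{T̂_m}(W, T̂_m) = 0`);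
* `persistenceSurface_of_nonGorensteinCompletionSat_of_completedStep'_of_restSingular` — the ROUTE DECL BY NAME from
  (0), (NĜ), CSP‴ and (L′) at singular steps (composition with `persistenceSurface_of_residual₄_of_completedStep'_of_rest'`
  and `levelFourPersistenceNonnormalOrNonrational'_of_singularSucc`, p795210).

NET reading of the saturation stub after this file: «`ca ⊆ ca⁴` at (i) the two-dimensional stage `0` with singular
successor outside the hypersurface-like classes (possibly non-normal), and (ii) the NORMAL two-dimensional stages with
singular successor whose COMPLETION is not Gorenstein» — (ii) is, by the evidence memo SAT4-RATIONAL-READING (item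
evidence #53), a finite special-module check at every RATIONAL such stage.

References: A. Bahlekeh, E. Hakimian, S. Salarian, R. Takahashi, Q. J. Math. 67 (2016), Thm. 4.5
[`BahlekehHakimianSalarianTakahashi2015`]; W. Bruns, J. Herzog, *Cohen–Macaulay rings*, Thm. 3.3.10 [`BrunsHerzog1998`];
S. B. Iyengar, R. Takahashi, IMRN 2016, §2 [`IyengarTakahashi2014`] — all used only through landed tree lemmas.
-/

noncomputable section

-- single-problem summit: the doubled namespace component `ResolutionOfSingularities` is forced
set_option linter.dupNamespace false

namespace Summit.ResolutionOfSingularities.ResolutionOfSingularities.Theorems.HomologicalConductor.PersistenceSurfaceSaturationResidualFourCompletionDoor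

open CategoryTheory CategoryTheory.Abelian IsLocalRing Literature.RingTheory.CohomologyAnnihilator
open Summit.ResolutionOfSingularities.ResolutionOfSingularities.Theorems
open Summit.ResolutionOfSingularities.ResolutionOfSingularities.Theorems.NoZeno.Birth
open Summit.ResolutionOfSingularities.ResolutionOfSingularities.Theorems.HomologicalConductor.PersistenceSurfaceSaturationResidual
open Summit.ResolutionOfSingularities.ResolutionOfSingularities.Theorems.HomologicalConductor.PersistenceSurfaceSaturationResidualThree
open Summit.ResolutionOfSingularities.ResolutionOfSingularities.Theorems.HomologicalConductor.PersistenceSurfaceSaturationResidualFour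
open Summit.ResolutionOfSingularities.ResolutionOfSingularities.Theorems.HomologicalConductor.PersistenceSurfaceSaturationResidualFourReduction
open Summit.ResolutionOfSingularities.ResolutionOfSingularities.Theorems.HomologicalConductor.PersistenceSurfaceSaturationCompletionGorenstein
open Summit.ResolutionOfSingularities.ResolutionOfSingularities.Theorems.HomologicalConductor.PersistenceSurfaceCompletedStepLevelFree
open Summit.ResolutionOfSingularities.ResolutionOfSingularities.Theorems.HomologicalConductor.PersistenceSurfaceLevelFreeRestSingular

/-- **The fourth residual with the Gorenstein input read on the completion.**  `SaturationFourSurfaceResidual₄` follows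
from (0) `Sat₄` at stage `0` under the residual clauses and (NĜ) `Sat₄` at every integrally closed residual stage
`↥(tower O A m)` whose `𝔪`-adic completion is NOT Gorenstein in the sense `∀ W f.g., ∀ i ≥ 3, Extⁱ_{T̂}(W, T̂) = 0`.  At a
stage with Gorenstein completion the conjunct is discharged by `ca_subset_caAt_of_completion_ext_eq_zero` (p807841): the
stage is a normal local domain of Krull dimension `2`, essentially of finite type over `k` (`tn_tower_invariant`), hence
an isolated singularity (`isIsolatedSingularity_of_isIntegrallyClosed_of_ringKrullDim_le_two`).
[cite: BahlekehHakimianSalarianTakahashi2015, Thm. 4.5; BrunsHerzog1998, Thm. 3.3.10] -/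
theorem saturationFourSurfaceResidual₄_of_stageZero_of_nonGorensteinCompletion
    (h0 : ∀ p : ℕ, p.Prime → ∀ (k K : Type) [Field k] [CharP k p] [Field K] [Algebra k K]
      (O : ValuationSubring K) (A : Subalgebra k K), (∀ c : k, algebraMap k K c ∈ O) → A.FG →
      IsFractionRing ↥A K → A.toSubring ≤ O.toSubring → ringKrullDim ↥A ≤ 2 →
      ¬ IsRegularLocalRing ↥(tower O A 0) → ¬ IsMonicHypersurfaceLocalization k 2 ↥(tower O A 0) →
      ¬ IsEdimHypersurfaceCandidate 2 ↥(tower O A 0) → ¬ IsRegularLocalRing ↥(tower O A 1) →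
      ringKrullDim ↥(tower O A 0) = (2 : ℕ) →
      {x : K | ∃ hx : x ∈ tower O A 0, ∃ n : ℕ, ∀ i : ℕ, n ≤ i → ∀ (M N : ModuleCat.{0} ↥(tower O A 0)),
          Module.Finite ↥(tower O A 0) M → Module.Finite ↥(tower O A 0) N →
            ∀ e : CategoryTheory.Abelian.Ext.{0} M N i, (⟨x, hx⟩ : ↥(tower O A 0)) • e = 0} ⊆
        {x : K | ∃ hx : x ∈ tower O A 0, ∀ i : ℕ, 4 ≤ i → ∀ (M N : ModuleCat.{0} ↥(tower O A 0)),
          Module.Finite ↥(tower O A 0) M → Module.Finite ↥(tower O A 0) N →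
            ∀ e : CategoryTheory.Abelian.Ext.{0} M N i, (⟨x, hx⟩ : ↥(tower O A 0)) • e = 0})
    (hNG : ∀ p : ℕ, p.Prime → ∀ (k K : Type) [Field k] [CharP k p] [Field K] [Algebra k K]
      (O : ValuationSubring K) (A : Subalgebra k K), (∀ c : k, algebraMap k K c ∈ O) → A.FG →
      IsFractionRing ↥A K → A.toSubring ≤ O.toSubring → ringKrullDim ↥A ≤ 2 → ∀ m : ℕ,
      IsIntegrallyClosed ↥(tower O A m) → ∀ [IsLocalRing ↥(tower O A m)],
      ¬ (∀ (W : ModuleCat.{0} (AdicCompletion (maximalIdeal ↥(tower O A m)) ↥(tower O A m))),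
          Module.Finite (AdicCompletion (maximalIdeal ↥(tower O A m)) ↥(tower O A m)) W → ∀ i : ℕ, 3 ≤ i →
          ∀ e : CategoryTheory.Abelian.Ext.{0} W
            (ModuleCat.of (AdicCompletion (maximalIdeal ↥(tower O A m)) ↥(tower O A m))
              (AdicCompletion (maximalIdeal ↥(tower O A m)) ↥(tower O A m))) i, e = 0) →
      ¬ IsRegularLocalRing ↥(tower O A m) → ¬ IsMonicHypersurfaceLocalization k 2 ↥(tower O A m) →
      ¬ IsEdimHypersurfaceCandidate 2 ↥(tower O A m) → ¬ IsRegularLocalRing ↥(tower O A (m + 1)) →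
      ringKrullDim ↥(tower O A m) = (2 : ℕ) →
      {x : K | ∃ hx : x ∈ tower O A m, ∃ n : ℕ, ∀ i : ℕ, n ≤ i → ∀ (M N : ModuleCat.{0} ↥(tower O A m)),
          Module.Finite ↥(tower O A m) M → Module.Finite ↥(tower O A m) N →
            ∀ e : CategoryTheory.Abelian.Ext.{0} M N i, (⟨x, hx⟩ : ↥(tower O A m)) • e = 0} ⊆
        {x : K | ∃ hx : x ∈ tower O A m, ∀ i : ℕ, 4 ≤ i → ∀ (M N : ModuleCat.{0} ↥(tower O A m)),
          Module.Finite ↥(tower O A m) M → Module.Finite ↥(tower O A m) N →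
            ∀ e : CategoryTheory.Abelian.Ext.{0} M N i, (⟨x, hx⟩ : ↥(tower O A m)) • e = 0}) :
    SaturationFourSurfaceResidual₄ := by
  refine saturationFourSurfaceResidual₄_of_stageZero_of_isIntegrallyClosed h0 ?_
  intro p hp k K _ _ _ _ O A hk hA hfr hAO hdim m hnorm hreg hmon hcand hsucc hdim2
  haveI : IsNoetherianRing ↥(tower O A m) := stub_towerNoetherian k K O A hk hA hfr hAO m
  haveI : IsLocalRing ↥(tower O A m) := by
    obtain ⟨B, hBO, hTB⟩ := exists_tower_eq_loc O A hk hAO m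
    rw [hTB, loc_eq_locAt]; exact SyzygyFlattening.isLocalRing_locAt O B hBO
  haveI := hnorm
  have hT : Algebra.EssFiniteType k ↥(tower O A m) := (tn_tower_invariant O A hk hA hfr hAO m).2.2
  have hisoT : IsIsolatedSingularity ↥(tower O A m) :=
    isIsolatedSingularity_of_isIntegrallyClosed_of_ringKrullDim_le_two (R := ↥(tower O A m))
      (by rw [hdim2]; norm_cast)
  by_cases hGor : ∀ (W : ModuleCat.{0} (AdicCompletion (maximalIdeal ↥(tower O A m)) ↥(tower O A m))),
      Module.Finite (AdicCompletion (maximalIdeal ↥(tower O A m)) ↥(tower O A m)) W → ∀ i : ℕ, 3 ≤ i →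
        ∀ e : CategoryTheory.Abelian.Ext.{0} W
          (ModuleCat.of (AdicCompletion (maximalIdeal ↥(tower O A m)) ↥(tower O A m))
            (AdicCompletion (maximalIdeal ↥(tower O A m)) ↥(tower O A m))) i, e = 0
  · exact ca_subset_caAt_of_completion_ext_eq_zero (tower O A m) hT hdim2 hisoT hGor (by norm_num)
  · exact hNG p hp k K O A hk hA hfr hAO hdim m hnorm hGor hreg hmon hcand hsucc hdim2

/-- **Door of record with the completion reading.**  `PersistenceSurface` (the route decl, by name) follows from:
(0) `Sat₄` at the two-dimensional stage `0` with singular successor outside the hypersurface-like classes;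
(NĜ) `Sat₄` at the NORMAL residual stages whose COMPLETION is not Gorenstein; CSP‴; and (L′) the level-free transfer on
the class Σ6 ∪ Σ8 at the steps into a singular stage from a two-dimensional stage (p795210).  Nothing is asserted;
every premise is a hypothesis. [cite: BahlekehHakimianSalarianTakahashi2015, Thm. 4.5; IyengarTakahashi2014, §2] -/
theorem persistenceSurface_of_nonGorensteinCompletionSat_of_completedStep'_of_restSingular
    (h0 : ∀ p : ℕ, p.Prime → ∀ (k K : Type) [Field k] [CharP k p] [Field K] [Algebra k K]
      (O : ValuationSubring K) (A : Subalgebra k K), (∀ c : k, algebraMap k K c ∈ O) → A.FG →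
      IsFractionRing ↥A K → A.toSubring ≤ O.toSubring → ringKrullDim ↥A ≤ 2 →
      ¬ IsRegularLocalRing ↥(tower O A 0) → ¬ IsMonicHypersurfaceLocalization k 2 ↥(tower O A 0) →
      ¬ IsEdimHypersurfaceCandidate 2 ↥(tower O A 0) → ¬ IsRegularLocalRing ↥(tower O A 1) →
      ringKrullDim ↥(tower O A 0) = (2 : ℕ) →
      {x : K | ∃ hx : x ∈ tower O A 0, ∃ n : ℕ, ∀ i : ℕ, n ≤ i → ∀ (M N : ModuleCat.{0} ↥(tower O A 0)),
          Module.Finite ↥(tower O A 0) M → Module.Finite ↥(tower O A 0) N →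
            ∀ e : CategoryTheory.Abelian.Ext.{0} M N i, (⟨x, hx⟩ : ↥(tower O A 0)) • e = 0} ⊆
        {x : K | ∃ hx : x ∈ tower O A 0, ∀ i : ℕ, 4 ≤ i → ∀ (M N : ModuleCat.{0} ↥(tower O A 0)),
          Module.Finite ↥(tower O A 0) M → Module.Finite ↥(tower O A 0) N →
            ∀ e : CategoryTheory.Abelian.Ext.{0} M N i, (⟨x, hx⟩ : ↥(tower O A 0)) • e = 0})
    (hNG : ∀ p : ℕ, p.Prime → ∀ (k K : Type) [Field k] [CharP k p] [Field K] [Algebra k K]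
      (O : ValuationSubring K) (A : Subalgebra k K), (∀ c : k, algebraMap k K c ∈ O) → A.FG →
      IsFractionRing ↥A K → A.toSubring ≤ O.toSubring → ringKrullDim ↥A ≤ 2 → ∀ m : ℕ,
      IsIntegrallyClosed ↥(tower O A m) → ∀ [IsLocalRing ↥(tower O A m)],
      ¬ (∀ (W : ModuleCat.{0} (AdicCompletion (maximalIdeal ↥(tower O A m)) ↥(tower O A m))),
          Module.Finite (AdicCompletion (maximalIdeal ↥(tower O A m)) ↥(tower O A m)) W → ∀ i : ℕ, 3 ≤ i →
          ∀ e : CategoryTheory.Abelian.Ext.{0} W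
            (ModuleCat.of (AdicCompletion (maximalIdeal ↥(tower O A m)) ↥(tower O A m))
              (AdicCompletion (maximalIdeal ↥(tower O A m)) ↥(tower O A m))) i, e = 0) →
      ¬ IsRegularLocalRing ↥(tower O A m) → ¬ IsMonicHypersurfaceLocalization k 2 ↥(tower O A m) →
      ¬ IsEdimHypersurfaceCandidate 2 ↥(tower O A m) → ¬ IsRegularLocalRing ↥(tower O A (m + 1)) →
      ringKrullDim ↥(tower O A m) = (2 : ℕ) →
      {x : K | ∃ hx : x ∈ tower O A m, ∃ n : ℕ, ∀ i : ℕ, n ≤ i → ∀ (M N : ModuleCat.{0} ↥(tower O A m)),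
          Module.Finite ↥(tower O A m) M → Module.Finite ↥(tower O A m) N →
            ∀ e : CategoryTheory.Abelian.Ext.{0} M N i, (⟨x, hx⟩ : ↥(tower O A m)) • e = 0} ⊆
        {x : K | ∃ hx : x ∈ tower O A m, ∀ i : ℕ, 4 ≤ i → ∀ (M N : ModuleCat.{0} ↥(tower O A m)),
          Module.Finite ↥(tower O A m) M → Module.Finite ↥(tower O A m) N →
            ∀ e : CategoryTheory.Abelian.Ext.{0} M N i, (⟨x, hx⟩ : ↥(tower O A m)) • e = 0})
    (hC : CompletedStepPersistenceRationalNormal')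
    (hL : ∀ p : ℕ, p.Prime → ∀ (k K : Type) [Field k] [CharP k p] [Field K] [Algebra k K]
      (O : ValuationSubring K) (A : Subalgebra k K), (∀ c : k, algebraMap k K c ∈ O) → A.FG →
      IsFractionRing ↥A K → A.toSubring ≤ O.toSubring → ringKrullDim ↥A ≤ 2 →
      ¬ ((IsIntegrallyClosed ↥(tower O A 0) ∧
          Literature.AlgebraicGeometry.Resolution.HasRationalSingularity ↥(tower O A 0)) ∨
        IsRegularLocalRing ↥(tower O A 0)) →
      ∀ m : ℕ, ¬ IsRegularLocalRing ↥(tower O A (m + 1)) → ringKrullDim ↥(tower O A m) = (2 : ℕ) →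
      {x : K | ∃ hx : x ∈ tower O A m, ∀ i : ℕ, 4 ≤ i → ∀ (M N : ModuleCat.{0} ↥(tower O A m)),
          Module.Finite ↥(tower O A m) M → Module.Finite ↥(tower O A m) N →
            ∀ e : CategoryTheory.Abelian.Ext.{0} M N i, (⟨x, hx⟩ : ↥(tower O A m)) • e = 0} ⊆
        ca (tower O A (m + 1))) :
    Summit.ResolutionOfSingularities.ResolutionOfSingularities.Theses.HomologicalConductor.PersistenceSurface :=
  persistenceSurface_of_residual₄_of_completedStep'_of_rest'
    (saturationFourSurfaceResidual₄_of_stageZero_of_nonGorensteinCompletion h0 hNG) hC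
    (levelFourPersistenceNonnormalOrNonrational'_of_singularSucc hL)

/-! ## Stage `0` absorbed when normal (appended) -/

/-- **The sharpest split: NON-NORMAL stage `0` / normal stages with non-Gorenstein completion.**
`SaturationFourSurfaceResidual₄` follows from (0♭) `Sat₄` at a stage `0` that is NOT integrally closed (under the residual
clauses) and (NĜ) `Sat₄` at every integrally closed residual stage — stage `0` included — whose completion is not
Gorenstein.  (Every stage `T_(m+1)` is integrally closed, `d2rc_isIntegrallyClosed_tower_succ`; a normal stage `0` is
handled exactly like the later stages.) [cite: BahlekehHakimianSalarianTakahashi2015, Thm. 4.5; BrunsHerzog1998, Thm. 3.3.10] -/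
theorem saturationFourSurfaceResidual₄_of_stageZero_nonnormal_of_nonGorensteinCompletion
    (h0 : ∀ p : ℕ, p.Prime → ∀ (k K : Type) [Field k] [CharP k p] [Field K] [Algebra k K]
      (O : ValuationSubring K) (A : Subalgebra k K), (∀ c : k, algebraMap k K c ∈ O) → A.FG →
      IsFractionRing ↥A K → A.toSubring ≤ O.toSubring → ringKrullDim ↥A ≤ 2 →
      ¬ IsIntegrallyClosed ↥(tower O A 0) →
      ¬ IsRegularLocalRing ↥(tower O A 0) → ¬ IsMonicHypersurfaceLocalization k 2 ↥(tower O A 0) →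
      ¬ IsEdimHypersurfaceCandidate 2 ↥(tower O A 0) → ¬ IsRegularLocalRing ↥(tower O A 1) →
      ringKrullDim ↥(tower O A 0) = (2 : ℕ) →
      {x : K | ∃ hx : x ∈ tower O A 0, ∃ n : ℕ, ∀ i : ℕ, n ≤ i → ∀ (M N : ModuleCat.{0} ↥(tower O A 0)),
          Module.Finite ↥(tower O A 0) M → Module.Finite ↥(tower O A 0) N →
            ∀ e : CategoryTheory.Abelian.Ext.{0} M N i, (⟨x, hx⟩ : ↥(tower O A 0)) • e = 0} ⊆
        {x : K | ∃ hx : x ∈ tower O A 0, ∀ i : ℕ, 4 ≤ i → ∀ (M N : ModuleCat.{0} ↥(tower O A 0)),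
          Module.Finite ↥(tower O A 0) M → Module.Finite ↥(tower O A 0) N →
            ∀ e : CategoryTheory.Abelian.Ext.{0} M N i, (⟨x, hx⟩ : ↥(tower O A 0)) • e = 0})
    (hNG : ∀ p : ℕ, p.Prime → ∀ (k K : Type) [Field k] [CharP k p] [Field K] [Algebra k K]
      (O : ValuationSubring K) (A : Subalgebra k K), (∀ c : k, algebraMap k K c ∈ O) → A.FG →
      IsFractionRing ↥A K → A.toSubring ≤ O.toSubring → ringKrullDim ↥A ≤ 2 → ∀ m : ℕ,
      IsIntegrallyClosed ↥(tower O A m) → ∀ [IsLocalRing ↥(tower O A m)],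
      ¬ (∀ (W : ModuleCat.{0} (AdicCompletion (maximalIdeal ↥(tower O A m)) ↥(tower O A m))),
          Module.Finite (AdicCompletion (maximalIdeal ↥(tower O A m)) ↥(tower O A m)) W → ∀ i : ℕ, 3 ≤ i →
          ∀ e : CategoryTheory.Abelian.Ext.{0} W
            (ModuleCat.of (AdicCompletion (maximalIdeal ↥(tower O A m)) ↥(tower O A m))
              (AdicCompletion (maximalIdeal ↥(tower O A m)) ↥(tower O A m))) i, e = 0) →
      ¬ IsRegularLocalRing ↥(tower O A m) → ¬ IsMonicHypersurfaceLocalization k 2 ↥(tower O A m) →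
      ¬ IsEdimHypersurfaceCandidate 2 ↥(tower O A m) → ¬ IsRegularLocalRing ↥(tower O A (m + 1)) →
      ringKrullDim ↥(tower O A m) = (2 : ℕ) →
      {x : K | ∃ hx : x ∈ tower O A m, ∃ n : ℕ, ∀ i : ℕ, n ≤ i → ∀ (M N : ModuleCat.{0} ↥(tower O A m)),
          Module.Finite ↥(tower O A m) M → Module.Finite ↥(tower O A m) N →
            ∀ e : CategoryTheory.Abelian.Ext.{0} M N i, (⟨x, hx⟩ : ↥(tower O A m)) • e = 0} ⊆
        {x : K | ∃ hx : x ∈ tower O A m, ∀ i : ℕ, 4 ≤ i → ∀ (M N : ModuleCat.{0} ↥(tower O A m)),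
          Module.Finite ↥(tower O A m) M → Module.Finite ↥(tower O A m) N →
            ∀ e : CategoryTheory.Abelian.Ext.{0} M N i, (⟨x, hx⟩ : ↥(tower O A m)) • e = 0}) :
    SaturationFourSurfaceResidual₄ := by
  -- the generic argument at an integrally closed residual stage (any `m`, stage `0` included)
  have key : ∀ p : ℕ, p.Prime → ∀ (k K : Type) [Field k] [CharP k p] [Field K] [Algebra k K]
      (O : ValuationSubring K) (A : Subalgebra k K), (∀ c : k, algebraMap k K c ∈ O) → A.FG →
      IsFractionRing ↥A K → A.toSubring ≤ O.toSubring → ringKrullDim ↥A ≤ 2 → ∀ m : ℕ,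
      IsIntegrallyClosed ↥(tower O A m) →
      ¬ IsRegularLocalRing ↥(tower O A m) → ¬ IsMonicHypersurfaceLocalization k 2 ↥(tower O A m) →
      ¬ IsEdimHypersurfaceCandidate 2 ↥(tower O A m) → ¬ IsRegularLocalRing ↥(tower O A (m + 1)) →
      ringKrullDim ↥(tower O A m) = (2 : ℕ) →
      {x : K | ∃ hx : x ∈ tower O A m, ∃ n : ℕ, ∀ i : ℕ, n ≤ i → ∀ (M N : ModuleCat.{0} ↥(tower O A m)),
          Module.Finite ↥(tower O A m) M → Module.Finite ↥(tower O A m) N →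
            ∀ e : CategoryTheory.Abelian.Ext.{0} M N i, (⟨x, hx⟩ : ↥(tower O A m)) • e = 0} ⊆
        {x : K | ∃ hx : x ∈ tower O A m, ∀ i : ℕ, 4 ≤ i → ∀ (M N : ModuleCat.{0} ↥(tower O A m)),
          Module.Finite ↥(tower O A m) M → Module.Finite ↥(tower O A m) N →
            ∀ e : CategoryTheory.Abelian.Ext.{0} M N i, (⟨x, hx⟩ : ↥(tower O A m)) • e = 0} := by
    intro p hp k K _ _ _ _ O A hk hA hfr hAO hdim m hnorm hreg hmon hcand hsucc hdim2
    haveI : IsNoetherianRing ↥(tower O A m) := stub_towerNoetherian k K O A hk hA hfr hAO m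
    haveI : IsLocalRing ↥(tower O A m) := by
      obtain ⟨B, hBO, hTB⟩ := exists_tower_eq_loc O A hk hAO m
      rw [hTB, loc_eq_locAt]; exact SyzygyFlattening.isLocalRing_locAt O B hBO
    haveI := hnorm
    have hT : Algebra.EssFiniteType k ↥(tower O A m) := (tn_tower_invariant O A hk hA hfr hAO m).2.2
    have hisoT : IsIsolatedSingularity ↥(tower O A m) :=
      isIsolatedSingularity_of_isIntegrallyClosed_of_ringKrullDim_le_two (R := ↥(tower O A m))
        (by rw [hdim2]; norm_cast)
    by_cases hGor : ∀ (W : ModuleCat.{0} (AdicCompletion (maximalIdeal ↥(tower O A m)) ↥(tower O A m))),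
        Module.Finite (AdicCompletion (maximalIdeal ↥(tower O A m)) ↥(tower O A m)) W → ∀ i : ℕ, 3 ≤ i →
          ∀ e : CategoryTheory.Abelian.Ext.{0} W
            (ModuleCat.of (AdicCompletion (maximalIdeal ↥(tower O A m)) ↥(tower O A m))
              (AdicCompletion (maximalIdeal ↥(tower O A m)) ↥(tower O A m))) i, e = 0
    · exact ca_subset_caAt_of_completion_ext_eq_zero (tower O A m) hT hdim2 hisoT hGor (by norm_num)
    · exact hNG p hp k K O A hk hA hfr hAO hdim m hnorm hGor hreg hmon hcand hsucc hdim2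
  refine saturationFourSurfaceResidual₄_of_stageZero_of_isIntegrallyClosed ?_ key
  intro p hp k K _ _ _ _ O A hk hA hfr hAO hdim hreg hmon hcand hsucc hdim2
  by_cases hnorm : IsIntegrallyClosed ↥(tower O A 0)
  · exact key p hp k K O A hk hA hfr hAO hdim 0 hnorm hreg hmon hcand hsucc hdim2
  · exact h0 p hp k K O A hk hA hfr hAO hdim hnorm hreg hmon hcand hsucc hdim2

end Summit.ResolutionOfSingularities.ResolutionOfSingularities.Theorems.HomologicalConductor.PersistenceSurfaceSaturationResidualFourCompletionDoor

end
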